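import Literature.NumberTheory.GaloisRepresentations.TateLevelOneLocalCharacters
import Literature.NumberTheory.GaloisRepresentations.LocalKroneckerWeberInertiaProofs
import Mathlib.RingTheory.ZMod.UnitsCyclic
import HarnessLib

/-!
# Tate's theorem `H²(G_ℚ, ℚ/ℤ) = 0` at level one, II: at `ℚ_p`, `p` odd, every locally constant
# character of `Γ_{ℚ_p}` is a `p`-th multiple (`H²(ℚ_p, ℤ/p) = 0`)

Sibling proof file (theorems only) of `TateProjectiveLifting.lean`, part of the level-one proof of
Tate's theorem over `ℚ` along Serre, Durham 1977, §6.5 (see `TateLevelOneLocalCharacters.lean`).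
At the place `p` itself (`p` odd) Serre's local statement "`δ(χ_v) = 0` iff `χ_v` is trivial on
`μ_p ⊂ K_v^×`" (§6.5 (b), via the structure of `ℚ_p^× = p^ℤ × μ_{p-1} × (1 + pℤ_p)`, which has no
`p`-torsion for `p` odd) becomes: **every locally constant additive character
`λ : Γ_{ℚ_p} → ℚ/ℤ` is `p • λ'` for a locally constant character `λ'`** — so that the Bockstein
`δ : H¹(ℚ_p, ℚ_p/ℤ_p) → H²(ℚ_p, ℤ/p)` vanishes and (with Tate's local theorem) `H²(ℚ_p, ℤ/p) = 0`.
On the Galois side the input is the local Kronecker–Weber theorem in inertia form, proved in the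
tree (`adicCompletion_rat_exists_eq_comp_cyclotomicCharacter_of_mem_absInertia`, Serre,
*Local Fields* XIV §7 Thm. 2: on `I_{ℚ_p}` every character factors through `χ_p mod p^m`), the
cyclicity of `(ℤ/p^{m+1})ˣ` for odd `p` (Mathlib `ZMod.isCyclic_units_of_prime_pow`), and the
divisibility of unramified characters (`unramified_character_nsmul_divisible`).

* `modNCyclotomicCharacter_eq_toZModPow_cyclotomicCharacter` — the mod `p^k` cyclotomic character is
  the reduction of the `p`-adic one;
* `unitsMap_modNCyclotomicCharacter_of_dvd` — compatibility `χ_{N'} ↦ χ_{N}` for `N ∣ N'`;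
* `isLocallyConstant_modNCyclotomicCharacter`, `modNCyclotomicCharacter_absGaloisRestrict` — local
  constancy, and compatibility with restriction `Γ_L → Γ_K`;
* `adicCompletion_rat_exists_mem_absInertia_modNCyclotomicCharacter_eq` — `χ_{p^m}(I_{ℚ_p}) = (ℤ/p^m)ˣ`;
* `cyclic_exists_character_apply_eq` — on a cyclic group `⟨c⟩`, a character with prescribed value
  `t` at `c` exists as soon as `t` is killed by the order of `c`;
* `cyclic_character_nsmul_divisible_of_apply_pow_eq_zero` — on a finite cyclic group `⟨c⟩` of order
  `p n''`, an additive character `h` with `h(c^{n''}) = 0` is `p • h'`;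
* `adicCompletion_rat_character_nsmul_divisible_odd` — **the theorem**: for `p` odd and `v ∣ p`,
  every locally constant additive character of `Γ_{ℚ_v}` with values in `ℚ/ℤ` is a `p`-th multiple
  of one.

## References

* J.-P. Serre, *Modular forms of weight one and Galois representations* (Durham 1977), §6.5 (b).
  [SerreDurham1977]
* J.-P. Serre, *Local Fields*, GTM 67 (1979), Ch. XIV §7, Thm. 2 (local Kronecker–Weber).
  [SerreLocalFields1979]
-/

noncomputable section

open Field ValuativeRel IsDedekindDomain
open scoped Pointwise Valued NumberField

namespace Literature.NumberTheory.GaloisRepresentations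

open GaloisRepresentations.IsNonarchimedeanLocalField

/-! ### Cyclotomic characters modulo `p^k` -/

section Cyclotomic

variable (K : Type*) [Field K] (p : ℕ) [Fact p.Prime] [NeZero (p : K)]

/-- The mod `p^k` cyclotomic character is the reduction modulo `p^k` of the `p`-adic cyclotomic
character (both are pinned down by the action on a primitive `p^k`-th root of unity). [folklore] -/
theorem modNCyclotomicCharacter_eq_toZModPow_cyclotomicCharacter (k : ℕ)
    [NeZero ((p ^ k : ℕ) : K)] (σ : absoluteGaloisGroup K) :
    (modNCyclotomicCharacter K (p ^ k) σ : ZMod (p ^ k)) =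
      PadicInt.toZModPow k (GaloisRep.cyclotomicCharacter K p σ : ℤ_[p]) := by
  haveI : NeZero (p ^ k) := ⟨pow_ne_zero _ (Fact.out : p.Prime).ne_zero⟩
  haveI : NeZero ((p ^ k : ℕ) : AlgebraicClosure K) :=
    NeZero.nat_of_injective (algebraMap K (AlgebraicClosure K)).injective
  obtain ⟨ζ, hζ⟩ := HasEnoughRootsOfUnity.exists_primitiveRoot (AlgebraicClosure K) (p ^ k)
  have h1 := GaloisRep.cyclotomicCharacter_spec K p (k := k) σ ζ hζ.pow_eq_one
  rw [modNCyclotomicCharacter_eq_of_smul_eq_pow K (p ^ k) hζ σ h1, ZMod.natCast_zmod_val]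

/-- As units: `χ_{p^k}(σ) = (χ_p(σ) mod p^k)`. [folklore] -/
theorem modNCyclotomicCharacter_eq_unitsMap_cyclotomicCharacter (k : ℕ)
    [NeZero ((p ^ k : ℕ) : K)] (σ : absoluteGaloisGroup K) :
    modNCyclotomicCharacter K (p ^ k) σ =
      Units.map (PadicInt.toZModPow k).toMonoidHom (GaloisRep.cyclotomicCharacter K p σ) :=
  Units.ext (by
    rw [modNCyclotomicCharacter_eq_toZModPow_cyclotomicCharacter, Units.coe_map]
    rfl)

end Cyclotomic

section CyclotomicDvd

variable (K : Type*) [Field K]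

/-- Compatibility of the mod `N'` and mod `N` cyclotomic characters under reduction, `N ∣ N'`.
[folklore] -/
theorem unitsMap_modNCyclotomicCharacter_of_dvd {N N' : ℕ} (h : N ∣ N') [NeZero N] [NeZero N']
    [NeZero (N : K)] [NeZero (N' : K)] (σ : absoluteGaloisGroup K) :
    ZMod.unitsMap h (modNCyclotomicCharacter K N' σ) = modNCyclotomicCharacter K N σ := by
  haveI : NeZero ((N : ℕ) : AlgebraicClosure K) :=
    NeZero.nat_of_injective (algebraMap K (AlgebraicClosure K)).injective
  obtain ⟨ζ, hζ⟩ := HasEnoughRootsOfUnity.exists_primitiveRoot (AlgebraicClosure K) N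
  have hζ' : ζ ^ N' = 1 := by
    obtain ⟨d, rfl⟩ := h
    rw [pow_mul, hζ.pow_eq_one, one_pow]
  have h1 := modNCyclotomicCharacter_spec K N' σ ζ hζ'
  have h2 := modNCyclotomicCharacter_eq_of_smul_eq_pow K N hζ σ h1
  ext
  rw [ZMod.unitsMap_def, Units.coe_map, MonoidHom.coe_coe, ZMod.castHom_apply, h2,
    ZMod.natCast_val]

/-- The mod `N` cyclotomic character is locally constant. [folklore] -/
theorem isLocallyConstant_modNCyclotomicCharacter (N : ℕ) [NeZero N] [NeZero (N : K)] :
    IsLocallyConstant (modNCyclotomicCharacter K N) := by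
  have hker : (((modNCyclotomicCharacter K N).ker : Subgroup _) : Set (absoluteGaloisGroup K)) ∈
      nhds (1 : absoluteGaloisGroup K) := by
    have hev := modNCyclotomicCharacter_eventually_eq_one K N
    rw [Filter.Eventually] at hev
    exact hev
  refine isLocallyConstant_of_mul_mem _ (modNCyclotomicCharacter K N).ker
    (Subgroup.isOpen_of_mem_nhds _ hker) fun σ u hu => ?_
  rw [map_mul, show modNCyclotomicCharacter K N u = 1 from hu, mul_one]

/-- The mod `N` cyclotomic character is compatible with restriction `Γ_L → Γ_K` along the chosen
embedding `K̄ → L̄` (both sides are pinned down by the action on a primitive `N`-th root of unity).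
Ref: Serre, *Abelian ℓ-adic representations* (1968), Ch. I §1.2. [folklore] -/
theorem modNCyclotomicCharacter_absGaloisRestrict (L : Type*) [Field L] [Algebra K L] (N : ℕ)
    [NeZero N] [NeZero (N : K)] [NeZero (N : L)] (σ : absoluteGaloisGroup L) :
    modNCyclotomicCharacter K N (absGaloisRestrict K L σ) = modNCyclotomicCharacter L N σ := by
  haveI : NeZero ((N : ℕ) : AlgebraicClosure K) :=
    NeZero.nat_of_injective (algebraMap K (AlgebraicClosure K)).injective
  obtain ⟨ζ, hζ⟩ := HasEnoughRootsOfUnity.exists_primitiveRoot (AlgebraicClosure K) N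
  have hζ' : IsPrimitiveRoot (absClosureEmbedding K L ζ) N :=
    hζ.map_of_injective (absClosureEmbedding K L).injective
  have h2 := modNCyclotomicCharacter_spec L N σ (absClosureEmbedding K L ζ) hζ'.pow_eq_one
  rw [← map_pow, ← absGaloisRestrict_apply_smul] at h2
  have h3 : absGaloisRestrict K L σ • ζ = ζ ^ ((modNCyclotomicCharacter L N σ : ZMod N)).val :=
    (absClosureEmbedding K L).injective h2
  ext
  rw [modNCyclotomicCharacter_eq_of_smul_eq_pow K N hζ _ h3, ZMod.natCast_val, ZMod.cast_id', id]

end CyclotomicDvd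


/-! ### Divisibility of characters of a cyclic group -/

section Cyclic

/-- **Characters of a finite cyclic group with prescribed value on a generator.**  If `G = ⟨c⟩`
and `t ∈ ℚ/ℤ` is killed by the order of `c`, there is an additive character `s` of (the
multiplicative group) `G` with `s(c) = t` (`s(c^i) = i • t`). [folklore] -/
theorem cyclic_exists_character_apply_eq {G : Type*} [Group G] (c : G)
    (hc : ∀ x, x ∈ Subgroup.zpowers c) (t : AddCircle (1 : ℚ)) (ht : (orderOf c) • t = 0) :
    ∃ s : G → AddCircle (1 : ℚ), (∀ x y, s (x * y) = s x + s y) ∧ s c = t := by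
  classical
  have hdvd : ∀ z : ℤ, (orderOf c : ℤ) ∣ z → z • t = 0 := fun z hz => by
    obtain ⟨d, rfl⟩ := hz
    rw [mul_comm, mul_zsmul, natCast_zsmul, ht, zsmul_zero]
  -- exponents
  have hex : ∀ x, ∃ i : ℤ, c ^ i = x := fun x => Subgroup.mem_zpowers_iff.mp (hc x)
  choose i hi using hex
  refine ⟨fun x => i x • t, fun x y => ?_, ?_⟩
  · have key : (orderOf c : ℤ) ∣ (i x + i y) - i (x * y) := by
      apply (Int.modEq_iff_dvd.mp)
      rw [← zpow_eq_zpow_iff_modEq, hi, zpow_add, hi, hi]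
    have h1 := hdvd _ key
    rw [sub_zsmul, add_zsmul, ← sub_eq_add_neg, sub_eq_zero] at h1
    exact h1.symm
  · change i c • t = t
    have key : (orderOf c : ℤ) ∣ i c - 1 := by
      apply (Int.modEq_iff_dvd.mp)
      rw [← zpow_eq_zpow_iff_modEq, zpow_one, hi]
    have h1 := hdvd _ key
    rw [sub_zsmul, one_zsmul, ← sub_eq_add_neg, sub_eq_zero] at h1
    exact h1

/-- **Characters of a finite cyclic group vanishing on the `p`-torsion are `p`-th multiples.**  Let
`G = ⟨c⟩` be cyclic of order `p n''`, and `h : G → ℚ/ℤ` an additive character (of the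
multiplicative group `G`) with `h(c ^ n'') = 0`.  Then `h = p • h'` for an additive character `h'`.
(`n'' • h(c) = 0`, so `h(c) = k/n''`; put `h'(c^i) = i k/(p n'')`.) [folklore] -/
theorem cyclic_character_nsmul_divisible_of_apply_pow_eq_zero {G : Type*} [Group G]
    (c : G) (hc : ∀ x, x ∈ Subgroup.zpowers c) {p n'' : ℕ} (hp : 0 < p) (hn'' : 0 < n'')
    (hord : orderOf c = p * n'') (h : G → AddCircle (1 : ℚ))
    (hadd : ∀ x y, h (x * y) = h x + h y) (hvan : h (c ^ n'') = 0) :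
    ∃ h' : G → AddCircle (1 : ℚ), (∀ x y, h' (x * y) = h' x + h' y) ∧ ∀ x, p • h' x = h x := by
  classical
  -- `h c = k / n''`
  obtain ⟨e, -, he_apply, he_surj⟩ := zmod_exists_addMonoidHom_addCircle hn''
  have hnt : n'' • h c = 0 := by rw [← character_apply_pow hadd, hvan]
  obtain ⟨k, hk⟩ := he_surj (h c) hnt
  haveI : NeZero n'' := ⟨hn''.ne'⟩
  -- `t' = k / (p n'')`
  set t' : AddCircle (1 : ℚ) := (((k.val : ℚ) / (p * n'' : ℕ) : ℚ) : AddCircle (1 : ℚ)) with ht'_def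
  have hpt' : p • t' = h c := by
    have h1 : h c = e (((k.val : ℕ) : ℤ) : ZMod n'') := by
      rw [Int.cast_natCast, ZMod.natCast_zmod_val, hk]
    rw [h1, he_apply, ht'_def, ← AddCircle.coe_nsmul, nsmul_eq_mul, Int.cast_natCast]
    congr 1
    have hp' : (p : ℚ) ≠ 0 := Nat.cast_ne_zero.2 hp.ne'
    have hn' : (n'' : ℚ) ≠ 0 := Nat.cast_ne_zero.2 hn''.ne'
    rw [Nat.cast_mul]
    field_simp
  have hordt' : (orderOf c) • t' = 0 := by
    rw [hord, ht'_def, ← AddCircle.coe_nsmul, nsmul_eq_mul,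
      mul_div_cancel₀ _ (Nat.cast_ne_zero.2 (Nat.mul_pos hp hn'').ne'),
      show ((k.val : ℕ) : ℚ) = (k.val : ℕ) • (1 : ℚ) by rw [nsmul_eq_mul, mul_one],
      AddCircle.coe_nsmul, AddCircle.coe_period, smul_zero]
  obtain ⟨h', hh'_add, hh'c⟩ := cyclic_exists_character_apply_eq c hc t' hordt'
  refine ⟨h', hh'_add, fun x => ?_⟩
  obtain ⟨i, rfl⟩ : ∃ i : ℤ, c ^ i = x := Subgroup.mem_zpowers_iff.mp (hc x)
  rw [character_apply_zpow hh'_add, character_apply_zpow hadd, hh'c, smul_comm, hpt']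

end Cyclic

/-! ### The theorem at `ℚ_p`, `p` odd -/

section RatPlace

open scoped Valued

variable (p : ℕ) [Fact p.Prime] (v : HeightOneSpectrum (𝓞 ℚ))

/-- `χ_{p^m}(I_{ℚ_v}) = (ℤ/p^m)ˣ` (`v ∣ p`): `ℚ_p(μ_{p^m})/ℚ_p` is totally ramified (from the tree's
`χ_p(I_{ℚ_v}) = ℤ_pˣ`). [cite: SerreLocalFields1979, Ch. IV §4 Prop. 17] -/
theorem adicCompletion_rat_exists_mem_absInertia_modNCyclotomicCharacter_eq
    (hv : (Rat.HeightOneSpectrum.primesEquiv v : ℕ) = p) {m : ℕ} (hm : 0 < m)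
    [NeZero (p : v.adicCompletion ℚ)] [NeZero ((p ^ m : ℕ) : v.adicCompletion ℚ)]
    (u : (ZMod (p ^ m))ˣ) :
    ∃ σ ∈ absInertia (v.adicCompletion ℚ),
      modNCyclotomicCharacter (v.adicCompletion ℚ) (p ^ m) σ = u := by
  obtain ⟨u', rfl⟩ := PadicInt.unitsMap_toZModPow_surjective p hm u
  obtain ⟨σ, hσ, hχ⟩ := adicCompletion_rat_exists_mem_absInertia_cyclotomicCharacter_eq p v hv u'
  exact ⟨σ, hσ, by rw [modNCyclotomicCharacter_eq_unitsMap_cyclotomicCharacter, hχ]⟩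

/-- **At `ℚ_p`, `p` odd, every locally constant character of `Γ_{ℚ_p}` is a `p`-th multiple**
(`v ∣ p`; Serre, Durham §6.5 (b) at the place `p`: `ℚ_p^×` has no `p`-torsion, so "`φ` is a
`p`-th power iff `φ` is trivial on `μ_p`" holds for every `φ`; equivalently `δ = 0` on
`H¹(ℚ_p, ℚ_p/ℤ_p)`, and with Tate's local theorem `H²(ℚ_p, ℤ/p) = 0`).  Proof on the Galois side:
by the local Kronecker–Weber theorem in inertia form
(`adicCompletion_rat_exists_eq_comp_cyclotomicCharacter_of_mem_absInertia`) `λ = g ∘ χ_{p^m}` on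
`I_{ℚ_p}`; the character `g ∘ π` of the cyclic group `(ℤ/p^{m+1})ˣ` vanishes on the `p`-torsion
`ker π`, hence is `p • h'` (`cyclic_character_nsmul_divisible_of_apply_pow_eq_zero`), so
`λ - p • (h' ∘ χ_{p^{m+1}})` is unramified, hence a `p`-th multiple
(`unramified_character_nsmul_divisible`).
[cite: SerreDurham1977, §6.5 (b)] [cite: SerreLocalFields1979, Ch. XIV §7 Thm. 2] -/
theorem adicCompletion_rat_character_nsmul_divisible_odd (hp2 : p ≠ 2)
    (hv : (Rat.HeightOneSpectrum.primesEquiv v : ℕ) = p)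
    (lam : absoluteGaloisGroup (v.adicCompletion ℚ) → AddCircle (1 : ℚ))
    (hlc : IsLocallyConstant lam) (hadd : ∀ σ τ, lam (σ * τ) = lam σ + lam τ) :
    ∃ lam' : absoluteGaloisGroup (v.adicCompletion ℚ) → AddCircle (1 : ℚ), IsLocallyConstant lam' ∧
      (∀ σ τ, lam' (σ * τ) = lam' σ + lam' τ) ∧ ∀ σ, p • lam' σ = lam σ := by
  classical
  have hp : p.Prime := Fact.out
  haveI : CharZero (v.adicCompletion ℚ) := charZero_adicCompletion (K := ℚ) v
  haveI hpF : NeZero (p : v.adicCompletion ℚ) := ⟨Nat.cast_ne_zero.mpr hp.ne_zero⟩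
  -- (1) local Kronecker–Weber on inertia
  obtain ⟨f, hf, hfker⟩ := exists_monoidHom_ker_iff hadd
  have hopen : IsOpen ((f.ker : Subgroup _) : Set (absoluteGaloisGroup (v.adicCompletion ℚ))) := by
    have : ((f.ker : Subgroup _) : Set (absoluteGaloisGroup (v.adicCompletion ℚ))) = lam ⁻¹' {0} := by
      ext τ
      exact hfker τ
    rw [this]
    exact hlc.isOpen_fiber 0
  obtain ⟨m, hm, g, hg⟩ :=
    adicCompletion_rat_exists_eq_comp_cyclotomicCharacter_of_mem_absInertia p v hv f hopen
      (fun a b => mul_comm _ _)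
  obtain ⟨m₀, rfl⟩ : ∃ m₀, m = m₀ + 1 := Nat.exists_eq_succ_of_ne_zero hm.ne'
  haveI : NeZero ((p ^ (m₀ + 1) : ℕ) : v.adicCompletion ℚ) :=
    ⟨by rw [Nat.cast_pow]; exact pow_ne_zero _ hpF.out⟩
  haveI : NeZero ((p ^ (m₀ + 1 + 1) : ℕ) : v.adicCompletion ℚ) :=
    ⟨by rw [Nat.cast_pow]; exact pow_ne_zero _ hpF.out⟩
  haveI : NeZero (p ^ (m₀ + 1)) := ⟨pow_ne_zero _ hp.ne_zero⟩
  haveI : NeZero (p ^ (m₀ + 1 + 1)) := ⟨pow_ne_zero _ hp.ne_zero⟩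
  have hI : ∀ σ ∈ absInertia (v.adicCompletion ℚ), lam σ =
      Multiplicative.toAdd (g (modNCyclotomicCharacter (v.adicCompletion ℚ) (p ^ (m₀ + 1)) σ)) :=
    fun σ hσ => by
      have h1 := hg σ hσ
      rw [hf] at h1
      rw [modNCyclotomicCharacter_eq_unitsMap_cyclotomicCharacter, ← h1, toAdd_ofAdd]
  -- (2) the cyclic group `(ℤ/p^{m+1})ˣ`, a generator `c`, the reduction `π`
  haveI : IsCyclic (ZMod (p ^ (m₀ + 1 + 1)))ˣ := ZMod.isCyclic_units_of_prime_pow p hp hp2 _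
  obtain ⟨c, hc⟩ := IsCyclic.exists_generator (α := (ZMod (p ^ (m₀ + 1 + 1)))ˣ)
  set π : (ZMod (p ^ (m₀ + 1 + 1)))ˣ →* (ZMod (p ^ (m₀ + 1)))ˣ :=
    ZMod.unitsMap (pow_dvd_pow p (m₀ + 1).le_succ) with hπ_def
  have hn'' : 0 < Fintype.card (ZMod (p ^ (m₀ + 1)))ˣ := Fintype.card_pos
  have hord : orderOf c = p * Fintype.card (ZMod (p ^ (m₀ + 1)))ˣ := by
    rw [orderOf_eq_card_of_forall_mem_zpowers hc, Nat.card_eq_fintype_card,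
      ZMod.card_units_eq_totient, ZMod.card_units_eq_totient, Nat.totient_prime_pow_succ hp,
      Nat.totient_prime_pow_succ hp, pow_succ]
    ring
  -- the character `h = g ∘ π` of the cyclic group, vanishing on `c ^ n''`
  set h : (ZMod (p ^ (m₀ + 1 + 1)))ˣ → AddCircle (1 : ℚ) :=
    fun x => Multiplicative.toAdd (g (π x)) with hh_def
  have hh_add : ∀ x y, h (x * y) = h x + h y := fun x y => by
    simp only [hh_def, map_mul, toAdd_mul]
  have hvan : h (c ^ Fintype.card (ZMod (p ^ (m₀ + 1)))ˣ) = 0 := by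
    simp only [hh_def]
    rw [map_pow, pow_card_eq_one, map_one, toAdd_one]
  obtain ⟨h', hh'_add, hh'⟩ := cyclic_character_nsmul_divisible_of_apply_pow_eq_zero c hc hp.pos
    hn'' hord h hh_add hvan
  -- (3) the character `μ' = h' ∘ χ_{p^{m+1}}` of `Γ`, with `p • μ' = lam` on inertia
  have hω_lc := isLocallyConstant_modNCyclotomicCharacter (v.adicCompletion ℚ) (p ^ (m₀ + 1 + 1))
  set μ' : absoluteGaloisGroup (v.adicCompletion ℚ) → AddCircle (1 : ℚ) :=
    fun σ => h' (modNCyclotomicCharacter (v.adicCompletion ℚ) (p ^ (m₀ + 1 + 1)) σ) with hμ'_def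
  have hμ'_lc : IsLocallyConstant μ' := hω_lc.comp h'
  have hμ'_add : ∀ σ τ, μ' (σ * τ) = μ' σ + μ' τ := fun σ τ => by
    simp only [hμ'_def, map_mul, hh'_add]
  have hpμ' : ∀ σ ∈ absInertia (v.adicCompletion ℚ), p • μ' σ = lam σ := fun σ hσ => by
    simp only [hμ'_def]
    rw [hh', hI σ hσ]
    simp only [hh_def, hπ_def]
    rw [unitsMap_modNCyclotomicCharacter_of_dvd]
  -- (4) `ν = lam - p • μ'` is unramified, hence divisible
  set ν : absoluteGaloisGroup (v.adicCompletion ℚ) → AddCircle (1 : ℚ) :=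
    fun σ => lam σ - p • μ' σ with hν_def
  have hν_lc : IsLocallyConstant ν := hlc.comp₂ hμ'_lc fun a b => a - p • b
  have hν_add : ∀ σ τ, ν (σ * τ) = ν σ + ν τ := fun σ τ => by
    simp only [hν_def, hadd, hμ'_add, nsmul_add]
    abel
  have hνI : ∀ σ ∈ absInertia (v.adicCompletion ℚ), ν σ = 0 := fun σ hσ => by
    simp only [hν_def, hpμ' σ hσ, sub_self]
  obtain ⟨ν', hν'_lc, hν'_add, -, hν'⟩ :=
    unramified_character_nsmul_divisible (v.adicCompletion ℚ) ν hν_lc hν_add hνI hp.pos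
  refine ⟨fun σ => μ' σ + ν' σ, hμ'_lc.comp₂ hν'_lc fun a b => a + b, fun σ τ => ?_, fun σ => ?_⟩
  · show μ' (σ * τ) + ν' (σ * τ) = (μ' σ + ν' σ) + (μ' τ + ν' τ)
    rw [hμ'_add, hν'_add]
    abel
  · show p • (μ' σ + ν' σ) = lam σ
    rw [nsmul_add, hν']
    show p • μ' σ + (lam σ - p • μ' σ) = lam σ
    abel

end RatPlace

end Literature.NumberTheory.GaloisRepresentations

end
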